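import Mathlib
import Summits.CriticalPhenomena.Ising3DConformalLimit.Theses.TauBallRounding
import HarnessLib

/-!
# `TauBallRounding.PlanarExactRounding` (item stmt-CriticalPhenomena-4811), proved

THEOREM-ONLY file (no definitions, no named facts). The support item `PlanarExactRounding` of
route `TauBallRounding` is a statement of one-variable calculus: with
`β_c := log (1 + √2) / 2` (so `sinh 2β_c = 1`, `cosh 2β_c = √2`, `coth β_c = 1 + √2`), the planar
anisotropy ratio of the square-lattice Ising model above `T_c`,

  `A₂(β) = N(β) / D(β)`,  `N(β) = -√2 · log sinh 2β`,  `D(β) = log coth β − 2β`,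

is antitone on `(0, β_c)` and `A₂(β) → 1` as `β ↑ β_c`.

Proof. `N(β_c) = D(β_c) = 0`, `D' = −2/sinh 2β − 2 < 0`, and
`N'/D' = h := √2 cosh 2β / (1 + sinh 2β)`, which satisfies `h(β_c) = 1` and
`h' = 2√2 (sinh 2β − 1)/(1 + sinh 2β)² ≤ 0` on `(0, β_c)`.
* Limit: L'Hôpital (`HasDerivAt.lhopital_zero_left_on_Ioo`).
* Monotonicity (the monotone form of L'Hôpital's rule, made explicit): `Φ := D·h − N` has
  `Φ' = D'h + Dh' − N' = D·h' ≤ 0` (because `D'·h = N'` identically and `D > 0` on `(0, β_c)`),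
  and `Φ(β_c) = 0`, so `Φ ≥ 0`, i.e. `N ≤ D·h` on `(0, β_c)`; multiplying by `D' < 0` gives
  `N'D − ND' = D'·(D·h − N) ≤ 0`, i.e. `A₂' ≤ 0`.

References (documentation of where the formula comes from; not used in the proof):
B. M. McCoy, T. T. Wu, *The two-dimensional Ising model* (1973); M. Campostrini, A. Pelissetto,
P. Rossi, E. Vicari, Phys. Rev. E 57 (1998) 184, §4.7; M. Holzer, Phys. Rev. Lett. 64 (1990) 653;
R. K. P. Zia, J. E. Avron, Phys. Rev. B 25 (1982) 2042; for the monotone L'Hôpital rule: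
G. D. Anderson, M. K. Vamanamurthy, M. Vuorinen, *Conformal invariants, inequalities, and
quasiconformal maps* (1997) Thm 1.25.
-/

noncomputable section

namespace Summit.CriticalPhenomena.Ising3DConformalLimit.Theorems

open Filter Set
open scoped Topology
open Summit.CriticalPhenomena.Ising3DConformalLimit.Theses

/-! ## The critical point `β_c = log (1 + √2) / 2` -/

/-- `0 < β_c`. -/
theorem planarRounding_betaC_pos : 0 < Real.log (1 + Real.sqrt 2) / 2 := by
  have h2 : 0 < Real.sqrt 2 := Real.sqrt_pos.mpr (by norm_num)
  have : 0 < Real.log (1 + Real.sqrt 2) := Real.log_pos (by linarith)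
  linarith

/-- `exp (2 β_c) = 1 + √2`. -/
theorem planarRounding_exp_two_mul_betaC :
    Real.exp (2 * (Real.log (1 + Real.sqrt 2) / 2)) = 1 + Real.sqrt 2 := by
  rw [show 2 * (Real.log (1 + Real.sqrt 2) / 2) = Real.log (1 + Real.sqrt 2) by ring]
  exact Real.exp_log (by positivity)

/-- `exp (-(2 β_c)) = √2 - 1`. -/
theorem planarRounding_exp_neg_two_mul_betaC :
    Real.exp (-(2 * (Real.log (1 + Real.sqrt 2) / 2))) = Real.sqrt 2 - 1 := by
  have hs : Real.sqrt 2 * Real.sqrt 2 = 2 := Real.mul_self_sqrt (by norm_num)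
  rw [Real.exp_neg, planarRounding_exp_two_mul_betaC]
  exact inv_eq_of_mul_eq_one_right (by linear_combination hs)

/-- `sinh (2 β_c) = 1`. -/
theorem planarRounding_sinh_two_mul_betaC :
    Real.sinh (2 * (Real.log (1 + Real.sqrt 2) / 2)) = 1 := by
  rw [Real.sinh_eq, planarRounding_exp_neg_two_mul_betaC, planarRounding_exp_two_mul_betaC]
  ring

/-- `cosh (2 β_c) = √2`. -/
theorem planarRounding_cosh_two_mul_betaC :
    Real.cosh (2 * (Real.log (1 + Real.sqrt 2) / 2)) = Real.sqrt 2 := by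
  rw [Real.cosh_eq, planarRounding_exp_neg_two_mul_betaC, planarRounding_exp_two_mul_betaC]
  ring

/-- `coth β_c = 1 + √2`. -/
theorem planarRounding_coth_betaC :
    Real.cosh (Real.log (1 + Real.sqrt 2) / 2) / Real.sinh (Real.log (1 + Real.sqrt 2) / 2)
      = 1 + Real.sqrt 2 := by
  set b := Real.log (1 + Real.sqrt 2) / 2 with hb
  have hsb : 0 < Real.sinh b := Real.sinh_pos_iff.mpr planarRounding_betaC_pos
  have h1 : Real.sinh (2 * b) = 1 := planarRounding_sinh_two_mul_betaC
  have h2 : Real.cosh (2 * b) = Real.sqrt 2 := planarRounding_cosh_two_mul_betaC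
  rw [Real.sinh_two_mul] at h1
  rw [Real.cosh_two_mul] at h2
  have h3 : Real.cosh b ^ 2 = Real.sinh b ^ 2 + 1 := Real.cosh_sq b
  rw [div_eq_iff hsb.ne']
  have h4 : Real.cosh b * (2 * Real.cosh b)
      = (1 + Real.sqrt 2) * Real.sinh b * (2 * Real.cosh b) := by
    linear_combination h2 + h3 - (1 + Real.sqrt 2) * h1
  exact mul_right_cancel₀ (by positivity) h4

/-- `D(β_c) = log coth β_c − 2β_c = 0`. -/
theorem planarRounding_D_betaC :
    Real.log (Real.cosh (Real.log (1 + Real.sqrt 2) / 2) / Real.sinh (Real.log (1 + Real.sqrt 2) / 2))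
      - 2 * (Real.log (1 + Real.sqrt 2) / 2) = 0 := by
  rw [planarRounding_coth_betaC]
  ring

/-- `N(β_c) = -√2 log sinh 2β_c = 0`. -/
theorem planarRounding_N_betaC :
    -(Real.sqrt 2 * Real.log (Real.sinh (2 * (Real.log (1 + Real.sqrt 2) / 2)))) = 0 := by
  rw [planarRounding_sinh_two_mul_betaC, Real.log_one]
  ring

/-- For `β < β_c`, `sinh 2β < 1`. -/
theorem planarRounding_sinh_two_mul_lt_one {β : ℝ} (hβ : β < Real.log (1 + Real.sqrt 2) / 2) :
    Real.sinh (2 * β) < 1 := by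
  calc Real.sinh (2 * β) < Real.sinh (2 * (Real.log (1 + Real.sqrt 2) / 2)) :=
        Real.sinh_lt_sinh.mpr (by linarith)
    _ = 1 := planarRounding_sinh_two_mul_betaC

/-! ## Derivatives of numerator `N`, denominator `D`, of `h = N'/D'` and of `Φ = D·h − N` -/

/-- `N' = -(2√2 cosh 2β / sinh 2β)` for `β > 0`. -/
theorem planarRounding_hasDerivAt_N {β : ℝ} (hβ : 0 < β) :
    HasDerivAt (fun β : ℝ => -(Real.sqrt 2 * Real.log (Real.sinh (2 * β))))
      (-(2 * Real.sqrt 2 * Real.cosh (2 * β) / Real.sinh (2 * β))) β := by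
  have hS : 0 < Real.sinh (2 * β) := Real.sinh_pos_iff.mpr (by linarith)
  have h1 : HasDerivAt (fun x : ℝ => 2 * x) 2 β := hasDerivAt_const_mul 2
  have h2 : HasDerivAt (fun x : ℝ => Real.sinh (2 * x)) (Real.cosh (2 * β) * 2) β :=
    (Real.hasDerivAt_sinh (2 * β)).comp β h1
  have h3 : HasDerivAt (fun x : ℝ => Real.log (Real.sinh (2 * x)))
      (Real.cosh (2 * β) * 2 / Real.sinh (2 * β)) β := h2.log hS.ne'
  have h4 : HasDerivAt (fun x : ℝ => -(Real.sqrt 2 * Real.log (Real.sinh (2 * x))))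
      (-(Real.sqrt 2 * (Real.cosh (2 * β) * 2 / Real.sinh (2 * β)))) β :=
    (h3.const_mul (Real.sqrt 2)).fun_neg
  exact h4.congr_deriv (by ring)

/-- `D' = -2 / sinh 2β − 2` for `β > 0`. -/
theorem planarRounding_hasDerivAt_D {β : ℝ} (hβ : 0 < β) :
    HasDerivAt (fun β : ℝ => Real.log (Real.cosh β / Real.sinh β) - 2 * β)
      (-2 / Real.sinh (2 * β) - 2) β := by
  have hs : 0 < Real.sinh β := Real.sinh_pos_iff.mpr hβ
  have hc : 0 < Real.cosh β := Real.cosh_pos β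
  have h1 : HasDerivAt (fun x : ℝ => 2 * x) 2 β := hasDerivAt_const_mul 2
  have h2 : HasDerivAt (fun x : ℝ => Real.cosh x / Real.sinh x)
      ((Real.sinh β * Real.sinh β - Real.cosh β * Real.cosh β) / Real.sinh β ^ 2) β :=
    (Real.hasDerivAt_cosh β).fun_div (Real.hasDerivAt_sinh β) hs.ne'
  have h3 : HasDerivAt (fun x : ℝ => Real.log (Real.cosh x / Real.sinh x))
      (((Real.sinh β * Real.sinh β - Real.cosh β * Real.cosh β) / Real.sinh β ^ 2)
        / (Real.cosh β / Real.sinh β)) β :=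
    h2.log (div_pos hc hs).ne'
  have h4 : HasDerivAt (fun x : ℝ => Real.log (Real.cosh x / Real.sinh x) - 2 * x)
      (((Real.sinh β * Real.sinh β - Real.cosh β * Real.cosh β) / Real.sinh β ^ 2)
        / (Real.cosh β / Real.sinh β) - 2) β := h3.fun_sub h1
  have h5 : Real.cosh β ^ 2 = Real.sinh β ^ 2 + 1 := Real.cosh_sq β
  have h6 : Real.sinh β * Real.sinh β - Real.cosh β * Real.cosh β = -1 := by nlinarith [h5]
  refine h4.congr_deriv ?_
  rw [h6, Real.sinh_two_mul]
  field_simp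

/-- `h' = 2√2 (sinh 2β − 1) / (1 + sinh 2β)²` for `β > 0`, where `h = √2 cosh 2β / (1 + sinh 2β)`
(`= N'/D'`). -/
theorem planarRounding_hasDerivAt_h {β : ℝ} (hβ : 0 < β) :
    HasDerivAt (fun β : ℝ => Real.sqrt 2 * Real.cosh (2 * β) / (1 + Real.sinh (2 * β)))
      (2 * Real.sqrt 2 * (Real.sinh (2 * β) - 1) / (1 + Real.sinh (2 * β)) ^ 2) β := by
  have hS : 0 < Real.sinh (2 * β) := Real.sinh_pos_iff.mpr (by linarith)
  have hS1 : (1 + Real.sinh (2 * β)) ≠ 0 := by linarith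
  have h1 : HasDerivAt (fun x : ℝ => 2 * x) 2 β := hasDerivAt_const_mul 2
  have h2 : HasDerivAt (fun x : ℝ => Real.sinh (2 * x)) (Real.cosh (2 * β) * 2) β :=
    (Real.hasDerivAt_sinh (2 * β)).comp β h1
  have h3 : HasDerivAt (fun x : ℝ => Real.cosh (2 * x)) (Real.sinh (2 * β) * 2) β :=
    (Real.hasDerivAt_cosh (2 * β)).comp β h1
  have h4 : HasDerivAt (fun x : ℝ => 1 + Real.sinh (2 * x)) (Real.cosh (2 * β) * 2) β :=
    h2.const_add 1
  have h5 : HasDerivAt (fun x : ℝ => Real.sqrt 2 * Real.cosh (2 * x) / (1 + Real.sinh (2 * x)))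
      ((Real.sqrt 2 * (Real.sinh (2 * β) * 2) * (1 + Real.sinh (2 * β))
        - Real.sqrt 2 * Real.cosh (2 * β) * (Real.cosh (2 * β) * 2)) / (1 + Real.sinh (2 * β)) ^ 2) β :=
    (h3.const_mul (Real.sqrt 2)).fun_div h4 hS1
  have h6 : Real.cosh (2 * β) ^ 2 = Real.sinh (2 * β) ^ 2 + 1 := Real.cosh_sq (2 * β)
  refine h5.congr_deriv ?_
  have h7 : Real.sqrt 2 * (Real.sinh (2 * β) * 2) * (1 + Real.sinh (2 * β))
        - Real.sqrt 2 * Real.cosh (2 * β) * (Real.cosh (2 * β) * 2)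
      = 2 * Real.sqrt 2 * (Real.sinh (2 * β) - 1) := by
    linear_combination (-(2 * Real.sqrt 2)) * h6
  rw [h7]

/-- `D'·h = N'` identically (`β > 0`). -/
theorem planarRounding_D'_mul_h {β : ℝ} (hβ : 0 < β) :
    (-2 / Real.sinh (2 * β) - 2) * (Real.sqrt 2 * Real.cosh (2 * β) / (1 + Real.sinh (2 * β)))
      = -(2 * Real.sqrt 2 * Real.cosh (2 * β) / Real.sinh (2 * β)) := by
  have hS : Real.sinh (2 * β) ≠ 0 := (Real.sinh_pos_iff.mpr (by linarith)).ne'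
  have hS1 : (1 + Real.sinh (2 * β)) ≠ 0 := by
    have := Real.sinh_pos_iff.mpr (show 0 < 2 * β by linarith); linarith
  field_simp
  ring

/-- The auxiliary function `Φ = D·h − N` has derivative `D·h'` (because `D'·h = N'`), `β > 0`. -/
theorem planarRounding_hasDerivAt_Phi {β : ℝ} (hβ : 0 < β) :
    HasDerivAt (fun β : ℝ => (Real.log (Real.cosh β / Real.sinh β) - 2 * β)
        * (Real.sqrt 2 * Real.cosh (2 * β) / (1 + Real.sinh (2 * β)))
        - -(Real.sqrt 2 * Real.log (Real.sinh (2 * β))))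
      ((Real.log (Real.cosh β / Real.sinh β) - 2 * β)
        * (2 * Real.sqrt 2 * (Real.sinh (2 * β) - 1) / (1 + Real.sinh (2 * β)) ^ 2)) β := by
  have h := ((planarRounding_hasDerivAt_D hβ).fun_mul (planarRounding_hasDerivAt_h hβ)).fun_sub
    (planarRounding_hasDerivAt_N hβ)
  exact h.congr_deriv (by linear_combination planarRounding_D'_mul_h hβ)

/-! ## Signs on `(0, β_c)` -/

/-- `D' < 0` for `β > 0`. -/
theorem planarRounding_D'_neg {β : ℝ} (hβ : 0 < β) : -2 / Real.sinh (2 * β) - 2 < 0 := by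
  have hS : 0 < Real.sinh (2 * β) := Real.sinh_pos_iff.mpr (by linarith)
  have : 0 < 2 / Real.sinh (2 * β) := by positivity
  rw [neg_div]
  linarith

/-- `D` is strictly decreasing on `(0, ∞)`. -/
theorem planarRounding_D_strictAntiOn :
    StrictAntiOn (fun β : ℝ => Real.log (Real.cosh β / Real.sinh β) - 2 * β) (Set.Ioi 0) := by
  refine strictAntiOn_of_deriv_neg (convex_Ioi 0)
    (fun x hx => (planarRounding_hasDerivAt_D hx).continuousAt.continuousWithinAt) ?_
  intro x hx
  rw [interior_Ioi] at hx
  rw [(planarRounding_hasDerivAt_D hx).deriv]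
  exact planarRounding_D'_neg hx

/-- `D > 0` on `(0, β_c)`. -/
theorem planarRounding_D_pos {β : ℝ} (h0 : 0 < β) (hβ : β < Real.log (1 + Real.sqrt 2) / 2) :
    0 < Real.log (Real.cosh β / Real.sinh β) - 2 * β := by
  have := planarRounding_D_strictAntiOn h0 planarRounding_betaC_pos hβ
  simpa only [planarRounding_D_betaC] using this

/-- `Φ = D·h − N ≥ 0` on `(0, β_c)`, i.e. `N ≤ D·h` (from `Φ' = D·h' ≤ 0` and `Φ(β_c) = 0`). -/
theorem planarRounding_N_le_D_mul_h {β : ℝ} (h0 : 0 < β) (hβ : β < Real.log (1 + Real.sqrt 2) / 2) :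
    -(Real.sqrt 2 * Real.log (Real.sinh (2 * β)))
      ≤ (Real.log (Real.cosh β / Real.sinh β) - 2 * β)
        * (Real.sqrt 2 * Real.cosh (2 * β) / (1 + Real.sinh (2 * β))) := by
  -- Φ is antitone on (0, β_c]
  have hanti : AntitoneOn (fun β : ℝ => (Real.log (Real.cosh β / Real.sinh β) - 2 * β)
        * (Real.sqrt 2 * Real.cosh (2 * β) / (1 + Real.sinh (2 * β)))
        - -(Real.sqrt 2 * Real.log (Real.sinh (2 * β))))
      (Set.Ioc 0 (Real.log (1 + Real.sqrt 2) / 2)) := by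
    refine antitoneOn_of_deriv_nonpos (convex_Ioc 0 _)
      (fun x hx => (planarRounding_hasDerivAt_Phi hx.1).continuousAt.continuousWithinAt) ?_ ?_
    · intro x hx
      rw [interior_Ioc] at hx
      exact (planarRounding_hasDerivAt_Phi hx.1).differentiableAt.differentiableWithinAt
    · intro x hx
      rw [interior_Ioc] at hx
      rw [(planarRounding_hasDerivAt_Phi hx.1).deriv]
      have hD : 0 < Real.log (Real.cosh x / Real.sinh x) - 2 * x := planarRounding_D_pos hx.1 hx.2
      have hS : 0 < Real.sinh (2 * x) := Real.sinh_pos_iff.mpr (by linarith [hx.1])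
      have hS1 : Real.sinh (2 * x) < 1 := planarRounding_sinh_two_mul_lt_one hx.2
      have hh' : 2 * Real.sqrt 2 * (Real.sinh (2 * x) - 1) / (1 + Real.sinh (2 * x)) ^ 2 ≤ 0 := by
        apply div_nonpos_of_nonpos_of_nonneg _ (by positivity)
        have h2 : 0 < Real.sqrt 2 := Real.sqrt_pos.mpr (by norm_num)
        have : 0 < 2 * Real.sqrt 2 * (1 - Real.sinh (2 * x)) := by positivity
        linarith
      exact mul_nonpos_of_nonneg_of_nonpos hD.le hh'
  -- Φ(β_c) = 0
  have hPhib : (Real.log (Real.cosh (Real.log (1 + Real.sqrt 2) / 2)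
          / Real.sinh (Real.log (1 + Real.sqrt 2) / 2)) - 2 * (Real.log (1 + Real.sqrt 2) / 2))
        * (Real.sqrt 2 * Real.cosh (2 * (Real.log (1 + Real.sqrt 2) / 2))
          / (1 + Real.sinh (2 * (Real.log (1 + Real.sqrt 2) / 2))))
        - -(Real.sqrt 2 * Real.log (Real.sinh (2 * (Real.log (1 + Real.sqrt 2) / 2)))) = 0 := by
    rw [planarRounding_D_betaC, planarRounding_N_betaC]
    ring
  have key : (Real.log (Real.cosh (Real.log (1 + Real.sqrt 2) / 2)
          / Real.sinh (Real.log (1 + Real.sqrt 2) / 2)) - 2 * (Real.log (1 + Real.sqrt 2) / 2))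
        * (Real.sqrt 2 * Real.cosh (2 * (Real.log (1 + Real.sqrt 2) / 2))
          / (1 + Real.sinh (2 * (Real.log (1 + Real.sqrt 2) / 2))))
        - -(Real.sqrt 2 * Real.log (Real.sinh (2 * (Real.log (1 + Real.sqrt 2) / 2))))
      ≤ (Real.log (Real.cosh β / Real.sinh β) - 2 * β)
        * (Real.sqrt 2 * Real.cosh (2 * β) / (1 + Real.sinh (2 * β)))
        - -(Real.sqrt 2 * Real.log (Real.sinh (2 * β))) :=
    hanti ⟨h0, hβ.le⟩ ⟨planarRounding_betaC_pos, le_rfl⟩ hβ.le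
  linarith [key, hPhib]

/-- The numerator of `A₂'`, `N'D − ND'`, is `≤ 0` on `(0, β_c)`. -/
theorem planarRounding_deriv_numerator_nonpos {β : ℝ} (h0 : 0 < β)
    (hβ : β < Real.log (1 + Real.sqrt 2) / 2) :
    -(2 * Real.sqrt 2 * Real.cosh (2 * β) / Real.sinh (2 * β))
        * (Real.log (Real.cosh β / Real.sinh β) - 2 * β)
      - -(Real.sqrt 2 * Real.log (Real.sinh (2 * β))) * (-2 / Real.sinh (2 * β) - 2) ≤ 0 := by
  have hle := planarRounding_N_le_D_mul_h h0 hβ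
  have hD' := planarRounding_D'_neg h0
  have key : -(2 * Real.sqrt 2 * Real.cosh (2 * β) / Real.sinh (2 * β))
        * (Real.log (Real.cosh β / Real.sinh β) - 2 * β)
      - -(Real.sqrt 2 * Real.log (Real.sinh (2 * β))) * (-2 / Real.sinh (2 * β) - 2)
      = (-2 / Real.sinh (2 * β) - 2)
        * ((Real.log (Real.cosh β / Real.sinh β) - 2 * β)
            * (Real.sqrt 2 * Real.cosh (2 * β) / (1 + Real.sinh (2 * β)))
          - -(Real.sqrt 2 * Real.log (Real.sinh (2 * β)))) := by
    rw [← planarRounding_D'_mul_h h0]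
    ring
  rw [key]
  exact mul_nonpos_of_nonpos_of_nonneg hD'.le (sub_nonneg.mpr hle)

/-! ## The two halves of the item -/

/-- **Antitone half.** `A₂` is antitone on `(0, β_c)`. -/
theorem planarRounding_antitoneOn :
    AntitoneOn (fun β : ℝ => -(Real.sqrt 2 * Real.log (Real.sinh (2 * β)))
        / (Real.log (Real.cosh β / Real.sinh β) - 2 * β))
      (Set.Ioo 0 (Real.log (1 + Real.sqrt 2) / 2)) := by
  have hderiv : ∀ x ∈ Set.Ioo 0 (Real.log (1 + Real.sqrt 2) / 2),
      HasDerivAt (fun β : ℝ => -(Real.sqrt 2 * Real.log (Real.sinh (2 * β)))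
        / (Real.log (Real.cosh β / Real.sinh β) - 2 * β))
      ((-(2 * Real.sqrt 2 * Real.cosh (2 * x) / Real.sinh (2 * x))
          * (Real.log (Real.cosh x / Real.sinh x) - 2 * x)
        - -(Real.sqrt 2 * Real.log (Real.sinh (2 * x))) * (-2 / Real.sinh (2 * x) - 2))
        / (Real.log (Real.cosh x / Real.sinh x) - 2 * x) ^ 2) x := by
    intro x hx
    exact (planarRounding_hasDerivAt_N hx.1).fun_div (planarRounding_hasDerivAt_D hx.1)
      (planarRounding_D_pos hx.1 hx.2).ne'
  refine antitoneOn_of_deriv_nonpos (convex_Ioo 0 _)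
    (fun x hx => (hderiv x hx).continuousAt.continuousWithinAt) ?_ ?_
  · intro x hx
    rw [interior_Ioo] at hx
    exact (hderiv x hx).differentiableAt.differentiableWithinAt
  · intro x hx
    rw [interior_Ioo] at hx
    rw [(hderiv x hx).deriv]
    exact div_nonpos_of_nonpos_of_nonneg (planarRounding_deriv_numerator_nonpos hx.1 hx.2)
      (sq_nonneg _)

/-- **Limit half.** `A₂(β) → 1` as `β ↑ β_c` (L'Hôpital). -/
theorem planarRounding_tendsto :
    Filter.Tendsto (fun β : ℝ => -(Real.sqrt 2 * Real.log (Real.sinh (2 * β)))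
        / (Real.log (Real.cosh β / Real.sinh β) - 2 * β))
      (nhdsWithin (Real.log (1 + Real.sqrt 2) / 2) (Set.Iio (Real.log (1 + Real.sqrt 2) / 2)))
      (nhds 1) := by
  have hb0 : 0 < Real.log (1 + Real.sqrt 2) / 2 := planarRounding_betaC_pos
  have hSb : Real.sinh (2 * (Real.log (1 + Real.sqrt 2) / 2)) = 1 :=
    planarRounding_sinh_two_mul_betaC
  have hCb : Real.cosh (2 * (Real.log (1 + Real.sqrt 2) / 2)) = Real.sqrt 2 :=
    planarRounding_cosh_two_mul_betaC
  have hs : Real.sqrt 2 * Real.sqrt 2 = 2 := Real.mul_self_sqrt (by norm_num)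
  refine HasDerivAt.lhopital_zero_left_on_Ioo hb0
    (f' := fun x => -(2 * Real.sqrt 2 * Real.cosh (2 * x) / Real.sinh (2 * x)))
    (g' := fun x => -2 / Real.sinh (2 * x) - 2)
    (fun x hx => planarRounding_hasDerivAt_N hx.1) (fun x hx => planarRounding_hasDerivAt_D hx.1)
    (fun x hx => (planarRounding_D'_neg hx.1).ne) ?_ ?_ ?_
  · -- N → N(β_c) = 0
    have hc := (planarRounding_hasDerivAt_N hb0).continuousAt.tendsto
    rw [planarRounding_N_betaC] at hc
    exact hc.mono_left nhdsWithin_le_nhds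
  · -- D → D(β_c) = 0
    have hc := (planarRounding_hasDerivAt_D hb0).continuousAt.tendsto
    rw [planarRounding_D_betaC] at hc
    exact hc.mono_left nhdsWithin_le_nhds
  · -- N'/D' is continuous at β_c with value (-4)/(-4) = 1
    have hc1 : ContinuousAt (fun x : ℝ => Real.sinh (2 * x)) (Real.log (1 + Real.sqrt 2) / 2) := by
      fun_prop
    have hc2 : ContinuousAt (fun x : ℝ => Real.cosh (2 * x)) (Real.log (1 + Real.sqrt 2) / 2) := by
      fun_prop
    have hSb0 : Real.sinh (2 * (Real.log (1 + Real.sqrt 2) / 2)) ≠ 0 := by rw [hSb]; norm_num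
    have hN' : ContinuousAt (fun x : ℝ => -(2 * Real.sqrt 2 * Real.cosh (2 * x) / Real.sinh (2 * x)))
        (Real.log (1 + Real.sqrt 2) / 2) :=
      ((continuousAt_const.mul hc2).div₀ hc1 hSb0).neg
    have hD' : ContinuousAt (fun x : ℝ => -2 / Real.sinh (2 * x) - 2)
        (Real.log (1 + Real.sqrt 2) / 2) :=
      (continuousAt_const.div₀ hc1 hSb0).sub continuousAt_const
    have hD'b : -2 / Real.sinh (2 * (Real.log (1 + Real.sqrt 2) / 2)) - 2 ≠ 0 :=
      (planarRounding_D'_neg hb0).ne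
    have hF : Filter.Tendsto
        (fun x : ℝ => -(2 * Real.sqrt 2 * Real.cosh (2 * x) / Real.sinh (2 * x))
          / (-2 / Real.sinh (2 * x) - 2))
        (nhds (Real.log (1 + Real.sqrt 2) / 2))
        (nhds (-(2 * Real.sqrt 2 * Real.cosh (2 * (Real.log (1 + Real.sqrt 2) / 2))
            / Real.sinh (2 * (Real.log (1 + Real.sqrt 2) / 2)))
          / (-2 / Real.sinh (2 * (Real.log (1 + Real.sqrt 2) / 2)) - 2))) :=
      (hN'.div₀ hD' hD'b).tendsto
    have hval : -(2 * Real.sqrt 2 * Real.cosh (2 * (Real.log (1 + Real.sqrt 2) / 2))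
            / Real.sinh (2 * (Real.log (1 + Real.sqrt 2) / 2)))
          / (-2 / Real.sinh (2 * (Real.log (1 + Real.sqrt 2) / 2)) - 2) = 1 := by
      rw [hSb, hCb]
      rw [show 2 * Real.sqrt 2 * Real.sqrt 2 = 4 by rw [mul_assoc, hs]; norm_num]
      norm_num
    rw [hval] at hF
    exact hF.mono_left nhdsWithin_le_nhds

/-- **`PlanarExactRounding` (item stmt-CriticalPhenomena-4811 of route `TauBallRounding`),
proved**: the planar anisotropy ratio `A₂(β) = -√2 log sinh 2β / (log coth β − 2β)` of the
square-lattice Ising model above `T_c` is antitone on `(0, β_c)`, `β_c = log (1 + √2) / 2`, and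
tends to `1` as `β ↑ β_c`. Pure calculus: L'Hôpital at `β_c` (`N(β_c) = D(β_c) = 0`,
`N'(β_c)/D'(β_c) = (-4)/(-4)`), and the monotone form of L'Hôpital's rule (`N'/D'` antitone)
run through the auxiliary function `Φ = D·(N'/D') − N`. Settles item stmt-CriticalPhenomena-4811
(exact signature). -/
theorem PlanarExactRounding_proof : TauBallRounding.PlanarExactRounding := by
  unfold TauBallRounding.PlanarExactRounding
  exact ⟨planarRounding_antitoneOn, planarRounding_tendsto⟩

end Summit.CriticalPhenomena.Ising3DConformalLimit.Theorems
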